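import Literature.Geometry.Lorentzian.WeightedNorms
import HarnessLib

/-!
# Hubble-saturated weighted Sobolev distance of initial data sets (capture norm for `Λ > 0`)

Family `gr`; definition request `defn-KerrDeSitterData` of route
`route-FinalStateConjecture-LambdaRegulator` (item `UniformKdSCapture`): a weighted Sobolev
distance on initial data sets over open subsets `U ⊆ E3` whose weights are the
Christodoulou–Klainerman / DHRT ones, `(1 + ‖x‖)^{δ+m}` on the `m`-th derivative, in the near zone
`‖x‖ ≪ H⁻¹` (`H = √(Λ/3)` the Hubble rate of the de Sitter end) and which saturate at the Hubble
length beyond it, and which **is** the distance `InitialDataSet.dataWeightedSobolevEDist s δ` of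
`WeightedNorms.lean` at `Λ = 0` (`dataWeightedSobolevEDistΛ_zero`).

## Definitions (namespace `Literature.Geometry.Lorentzian`)

* `hubbleWeight Λ x = (1 + ‖x‖)/(1 + H‖x‖)`, `H = √(Λ/3)`: equals `1 + ‖x‖` for `Λ = 0`
  (`hubbleWeight_zero_left`), is `≍ 1 + ‖x‖` for `‖x‖ ≲ H⁻¹` and `→ H⁻¹` as `‖x‖ → ∞`; always
  `0 < hubbleWeight Λ x ≤ 1 + ‖x‖` for `Λ ≥ 0`.
* `weightedSobolevSeminormΛ Λ U s δ f = (∑_{m ≤ s} ∫_U w_Λ^{2(δ+m)} ‖Dᵐ f‖²)^{1/2}` — the seminorm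
  `weightedSobolevSeminorm` of `WeightedNorms.lean` with `1 + ‖x‖` replaced by `w_Λ = hubbleWeight Λ`
  (so each derivative is measured in units of `min(1 + ‖x‖, H⁻¹)`).
* `InitialDataSet.dataWeightedSobolevEDistΛ s δ Λ D₁ D₂ = ‖h₁ − h₂‖_{H^s_{δ,Λ}} + ‖k₁ − k₂‖_{H^{s-1}_{δ+1,Λ}}`
  on data over an open `U ⊆ E3`, with `dataWeightedSobolevEDistΛ s δ 0 = dataWeightedSobolevEDist s δ`.

## Design and sources

There is no canonical norm in print for perturbations of Kerr–de Sitter data on a slice reaching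
across the cosmological horizon to the conformal boundary: Hintz–Vasy (Acta Math. 220 (2018),
Thm. 1.4) and Fang (arXiv:2112.07183) pose data on the *compact* slice `{t* = 0, r₋-ε ≤ r ≤ r_c+ε}`
and measure them in unweighted `H^s`; the `Λ = 0` problems (Christodoulou–Klainerman 1993, (1.0.9);
Klainerman–Szeftel 2023; DHRT arXiv:2104.08222) use the polynomially weighted `H^s_δ × H^{s-1}_{δ+1}`
of Bartnik, CPAM 39 (1986), (1.2). The present definition is the minimal interpolation requested by
the route: polynomial weights up to the Hubble scale, unweighted (`H^s` in Hubble units) beyond, and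
literally the `Λ = 0` distance at `Λ = 0`. Conventions (`δ`-sign, Cartesian `iteratedFDeriv`,
Lebesgue measure of `E3`, values in `ℝ≥0∞`, junk `s - 1 = 0` for `s = 0`) are those of
`WeightedNorms.lean`.

## References

* R. Bartnik, *The mass of an asymptotically flat manifold*, CPAM 39 (1986), (1.2).
* D. Christodoulou, S. Klainerman, *The global nonlinear stability of the Minkowski space* (1993),
  (1.0.9).
* P. Hintz, A. Vasy, Acta Math. 220 (2018), Thm. 1.4 (`H^s` data on the compact slice `Σ₀`).
* A. J. Fang, arXiv:2112.07183.
-/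

open Manifold Bundle TopologicalSpace MeasureTheory
open scoped ContDiff Topology ENNReal NNReal

noncomputable section

namespace Literature.Geometry.Lorentzian

/-! ### The Hubble-saturated weight -/

section Weight

variable {F : Type*} [NormedAddCommGroup F]

/-- The **Hubble-saturated radial weight** `w_Λ(x) = (1 + ‖x‖)/(1 + H‖x‖)`, `H = √(Λ/3)`: it is
`1 + ‖x‖` for `Λ = 0` and for `‖x‖ ≪ H⁻¹`, and tends to the Hubble length `H⁻¹` as `‖x‖ → ∞`
(for `Λ < 0`, `Real.sqrt` clips and `w_Λ = 1 + ‖x‖`). Bartnik 1986, (1.2) (the weight `σ ≍ 1 + |x|`);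
Hintz–Vasy 2018, Thm. 1.4 (no weight on the cosmological side). [cite: Bartnik1986, (1.2)] -/
def hubbleWeight (Λ : ℝ) (x : F) : ℝ := (1 + ‖x‖) / (1 + √(Λ / 3) * ‖x‖)

/-- At `Λ = 0` the Hubble weight is Bartnik's `1 + ‖x‖` (Bartnik 1986, (1.2)). [cite: Bartnik1986, (1.2)] -/
@[simp]
theorem hubbleWeight_zero_left (x : F) : hubbleWeight 0 x = 1 + ‖x‖ := by
  simp [hubbleWeight]

/-- The Hubble weight is positive (Bartnik 1986, (1.2)). [cite: Bartnik1986, (1.2)] -/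
theorem hubbleWeight_pos (Λ : ℝ) (x : F) : 0 < hubbleWeight Λ x := by
  unfold hubbleWeight
  have h1 : 0 ≤ √(Λ / 3) * ‖x‖ := by positivity
  have h2 : 0 ≤ ‖x‖ := norm_nonneg x
  exact div_pos (by linarith) (by linarith)

/-- The Hubble weight is at most Bartnik's weight: `w_Λ(x) ≤ 1 + ‖x‖` (Bartnik 1986, (1.2)). [cite: Bartnik1986, (1.2)] -/
theorem hubbleWeight_le (Λ : ℝ) (x : F) : hubbleWeight Λ x ≤ 1 + ‖x‖ := by
  unfold hubbleWeight
  have h1 : 0 ≤ √(Λ / 3) * ‖x‖ := by positivity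
  have h2 : 0 ≤ ‖x‖ := norm_nonneg x
  rw [div_le_iff₀ (by linarith)]
  nlinarith

/-- The Hubble weight never exceeds the Hubble length by more than one: `H · w_Λ(x) ≤ 1 + H` with
`H = √(Λ/3)` (so `w_Λ ≤ H⁻¹ + 1` on the cosmological side). Hintz–Vasy 2018, §3.1 (the
cosmological scale `r ≍ Λ^{-1/2}`). [cite: HintzVasy2018, §3.1] -/
theorem sqrt_mul_hubbleWeight_le (Λ : ℝ) (x : F) :
    √(Λ / 3) * hubbleWeight Λ x ≤ 1 + √(Λ / 3) := by
  unfold hubbleWeight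
  have h1 : 0 ≤ √(Λ / 3) := Real.sqrt_nonneg _
  have h2 : 0 ≤ ‖x‖ := norm_nonneg x
  have h3 : 0 < 1 + √(Λ / 3) * ‖x‖ := by positivity
  rw [mul_div_assoc', div_le_iff₀ h3]
  nlinarith [mul_nonneg h1 h2]

end Weight

/-! ### The Hubble-saturated weighted Sobolev seminorm -/

section Seminorm

variable {F G : Type*} [NormedAddCommGroup F] [NormedSpace ℝ F] [NormedAddCommGroup G]
  [NormedSpace ℝ G] [MeasureSpace F]

/-- The **Hubble-saturated weighted Sobolev seminorm** `H^s_{δ,Λ}` of `f : F → G` over `U ⊆ F`: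
`(∑_{m=0}^{s} ∫_U w_Λ(x)^{2(δ+m)} ‖Dᵐ f(x)‖² dx)^{1/2} ∈ [0, ∞]`, i.e. `weightedSobolevSeminorm`
(Bartnik 1986, (1.2); Christodoulou–Klainerman 1993, §1) with the weight `1 + ‖x‖` replaced by
`hubbleWeight Λ x`; for `Λ = 0` it is that seminorm (`weightedSobolevSeminormΛ_zero_left`).
Conventions as in `WeightedNorms.lean` (larger `δ` = faster decay; classical `iteratedFDeriv`). [cite: Bartnik1986, (1.2)] -/
def weightedSobolevSeminormΛ (Λ : ℝ) (U : Set F) (s : ℕ) (δ : ℝ) (f : F → G) : ℝ≥0∞ :=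
  (∑ m ∈ Finset.range (s + 1),
      ∫⁻ x in U, ENNReal.ofReal
        (hubbleWeight Λ x ^ (2 * (δ + m) : ℝ) * ‖iteratedFDeriv ℝ m f x‖ ^ 2)) ^ (1 / 2 : ℝ)

/-- At `Λ = 0` the Hubble-saturated seminorm is the weighted Sobolev seminorm `H^s_δ` of
`WeightedNorms.lean` (Bartnik 1986, (1.2)). [cite: Bartnik1986, (1.2)] -/
@[simp]
theorem weightedSobolevSeminormΛ_zero_left (U : Set F) (s : ℕ) (δ : ℝ) (f : F → G) :
    weightedSobolevSeminormΛ 0 U s δ f = weightedSobolevSeminorm U s δ f := by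
  simp [weightedSobolevSeminormΛ, weightedSobolevSeminorm]

/-- The Hubble-saturated seminorm of the zero function vanishes (Bartnik 1986, (1.2)). [cite: Bartnik1986, (1.2)] -/
@[simp]
theorem weightedSobolevSeminormΛ_zero (Λ : ℝ) (U : Set F) (s : ℕ) (δ : ℝ) :
    weightedSobolevSeminormΛ Λ U s δ (0 : F → G) = 0 := by
  simp [weightedSobolevSeminormΛ]

/-- The Hubble-saturated seminorm is invariant under `f ↦ -f` (Bartnik 1986, (1.2)). [cite: Bartnik1986, (1.2)] -/
@[simp]
theorem weightedSobolevSeminormΛ_neg (Λ : ℝ) (U : Set F) (s : ℕ) (δ : ℝ) (f : F → G) :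
    weightedSobolevSeminormΛ Λ U s δ (-f) = weightedSobolevSeminormΛ Λ U s δ f := by
  simp [weightedSobolevSeminormΛ, iteratedFDeriv_neg]

/-- The Hubble-saturated seminorm is monotone in the set (Bartnik 1986, (1.2)). [cite: Bartnik1986, (1.2)] -/
theorem weightedSobolevSeminormΛ_mono (Λ : ℝ) {U V : Set F} (h : U ⊆ V) (s : ℕ) (δ : ℝ)
    (f : F → G) : weightedSobolevSeminormΛ Λ U s δ f ≤ weightedSobolevSeminormΛ Λ V s δ f := by
  unfold weightedSobolevSeminormΛ
  gcongr

end Seminorm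

/-! ### The capture distance of initial data sets -/

namespace InitialDataSet

variable {U : Opens E3}

/-- The **Hubble-saturated weighted Sobolev distance of two initial data sets** on the same open
`U ⊆ E3` (the capture norm of the `Λ`-uniform Kerr–de Sitter stability statements):
`‖h₁ − h₂‖_{H^s_{δ,Λ}(U)} + ‖k₁ − k₂‖_{H^{s-1}_{δ+1,Λ}(U)} ∈ [0, ∞]`, the `k`-part with one derivative
less and one more power of the weight as in Christodoulou–Klainerman 1993, (1.0.9); for `Λ = 0`
it is `dataWeightedSobolevEDist s δ` (`dataWeightedSobolevEDistΛ_zero`). Components `hFun`, `kFun`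
and all conventions from `WeightedNorms.lean`. [cite: ChristodoulouKlainerman1993, (1.0.9)] -/
def dataWeightedSobolevEDistΛ (s : ℕ) (δ Λ : ℝ) (D₁ D₂ : InitialDataSet 𝓘(ℝ, E3) U) : ℝ≥0∞ :=
  weightedSobolevSeminormΛ Λ (U : Set E3) s δ (D₁.hFun - D₂.hFun) +
    weightedSobolevSeminormΛ Λ (U : Set E3) (s - 1) (δ + 1) (D₁.kFun - D₂.kFun)

/-- At `Λ = 0` the capture distance is the weighted Sobolev distance `H^s_δ × H^{s-1}_{δ+1}` of
`WeightedNorms.lean` (Christodoulou–Klainerman 1993, (1.0.9)). [cite: ChristodoulouKlainerman1993, (1.0.9)] -/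
@[simp]
theorem dataWeightedSobolevEDistΛ_zero (s : ℕ) (δ : ℝ) (D₁ D₂ : InitialDataSet 𝓘(ℝ, E3) U) :
    dataWeightedSobolevEDistΛ s δ 0 D₁ D₂ = dataWeightedSobolevEDist s δ D₁ D₂ := by
  simp [dataWeightedSobolevEDistΛ, dataWeightedSobolevEDist]

/-- The capture distance of a data set to itself is `0` (Bartnik 1986, (1.2)). [cite: Bartnik1986, (1.2)] -/
@[simp]
theorem dataWeightedSobolevEDistΛ_self (s : ℕ) (δ Λ : ℝ) (D : InitialDataSet 𝓘(ℝ, E3) U) :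
    dataWeightedSobolevEDistΛ s δ Λ D D = 0 := by
  have h₁ : D.hFun - D.hFun = 0 := funext fun y => sub_self (D.hFun y)
  have h₂ : D.kFun - D.kFun = 0 := funext fun y => sub_self (D.kFun y)
  rw [dataWeightedSobolevEDistΛ, h₁, h₂, weightedSobolevSeminormΛ_zero, weightedSobolevSeminormΛ_zero,
    add_zero]

/-- The capture distance is symmetric (Bartnik 1986, (1.2)). [cite: Bartnik1986, (1.2)] -/
theorem dataWeightedSobolevEDistΛ_comm (s : ℕ) (δ Λ : ℝ) (D₁ D₂ : InitialDataSet 𝓘(ℝ, E3) U) :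
    dataWeightedSobolevEDistΛ s δ Λ D₁ D₂ = dataWeightedSobolevEDistΛ s δ Λ D₂ D₁ := by
  have h₁ : D₁.hFun - D₂.hFun = -(D₂.hFun - D₁.hFun) :=
    funext fun y => (neg_sub (D₂.hFun y) (D₁.hFun y)).symm
  have h₂ : D₁.kFun - D₂.kFun = -(D₂.kFun - D₁.kFun) :=
    funext fun y => (neg_sub (D₂.kFun y) (D₁.kFun y)).symm
  rw [dataWeightedSobolevEDistΛ, dataWeightedSobolevEDistΛ, h₁, h₂, weightedSobolevSeminormΛ_neg,
    weightedSobolevSeminormΛ_neg]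

end InitialDataSet

end Literature.Geometry.Lorentzian

end
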